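import Summits.CriticalPhenomena.PercolationContinuityZ3.Theorems.PercLowPointHalfSpaceBoundaryTwoArmDecayStubStepSymm
import Literature.Probability.Percolation.SeedLemma

/-!
# Stub `stub_step` of crux `BoundaryTwoArmDecay` (stmt-CriticalPhenomena-0911), part 3: counting partner-kiss
# edges on the confined event, Markov, and the level densities

Helper file for the stub `stub_step` (ONE ROUND of the bootstrap) of the crux skeleton
`Cruxes/BoundaryTwoArmDecay/Lines/staircase_bootstrap_floor_decoupling.lean` (line
`staircase-bootstrap-floor-decoupling`, crux `PercLowPointHalfSpace.BoundaryTwoArmDecay`); lands with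
`--supports stmt-CriticalPhenomena-0911`.  Part 1 (`…StubStepSymm`) has the kiss event `kissV m x j` and its
floor symmetries; part 2 (`…StubStepSums`) the real-variable inequalities.

Objects (same bodies as in the skeleton where the skeleton has them):

* `partnerKiss n ω` — the ordered floor edges `(q₁, q₂)` with `0 ↔_ℍ q₁`, `0 ↮_ℍ q₂`, `C_ℍ(q₂)` meeting level `n`
  (the skeleton's `partnerKiss`; `K_n = (partnerKiss n ω).ncard`);
* `conf n` — `U = C_ℍ(0)` stays in the open sup-ball of radius `3n` (the skeleton's `confined (3 * n)`);
* the DYADIC COVER: floor boxes `floorBox R`, the groups `grp k` of floor roots `x` with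
  `3·2^k ≤ |x|_floor ≤ 8·2^k`, the admissible scales `scales d₀ n = {k ≤ log₂ n | d₀ ≤ 2^k}`, the index set
  `idx d₀ n = Σ_{k ∈ scales} grp k × {e₁, e₂}`, the cover `cover d₀ n ω` of `partnerKiss n ω` and the counting
  majorant `bigN d₀ n ω = 2 #floorBox(6d₀+2) + Σ_{⟨k,x,j⟩ ∈ idx} 1{ω ∈ kissV (2^k) x j}`.

Content:

* (S2) `ncard_partnerKiss_le`: on `A_n ∩ conf n`, `K_n ≤ 2 · bigN d₀ n ω` — every partner-kiss edge has a root
  `x` (floor site, `|x|_floor ≤ 3n`) with `kissV m x j` for all `m ≤ n`; near roots are covered by the small floor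
  box, far roots by the dyadic group `k = ⌊log₂ (|x|_floor / 3)⌋` (`3·2^k ≤ |x|_floor`, `d₀ ≤ 2^k ≤ n`);
* (S3) `inter_conf_subset_union` (the split `A ∩ conf ⊆ (A ∩ {K ≤ k}) ∪ (A ∩ {k < 2N})`) and the MARKOV bound
  `markov_bigN`: `(k+1) P(A ∩ {k < 2N}) ≤ 4 #F_small P(A) + 2 Σ_{idx} P(A ∩ kissV (2^k) x j)`;
* (S6, first line) `sum_exactDens_le_tallDens`: `Σ_{m ∈ I} e_m ≤ ν_N` for `I ⊆ [N, ∞)` (the exact-height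
  events are pairwise disjoint and lie in `{U meets level N}`) — the registered sub-goal `stub_step_count`.

References: G. Grimmett, *Percolation*, 2nd ed. (1999), §1.6, §7.2.
-/

noncomputable section

namespace Summit.CriticalPhenomena.PercolationContinuityZ3.Theorems.BoundaryTwoArmDecay

open MeasureTheory
open scoped ENNReal Classical
open Literature.Probability.Percolation Literature.Probability.LatticeModels

namespace StubStep

open Negative (μ)

/-! ### Objects -/

/-- Floor sup-distance of a site from the normal axis (the skeleton's `floorSup`). -/
def floorSup (x : Site 3) : ℕ := max (x 1).natAbs (x 2).natAbs

/-- Partner-kiss edges of `U` (the skeleton's `partnerKiss`): ordered floor edges `(q₁, q₂)` with `0 ↔_ℍ q₁`,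
`0 ↮_ℍ q₂`, `C_ℍ(q₂)` meeting level `n`. -/
def partnerKiss (n : ℕ) (ω : BondConfig (Site 3)) : Set (Site 3 × Site 3) :=
  {q | q.1 0 = 0 ∧ q.2 0 = 0 ∧ (zdGraph 3).Adj q.1 q.2 ∧ ω ∈ openConnIn (halfSpace 3) 0 q.1 ∧
       ω ∉ openConnIn (halfSpace 3) 0 q.2 ∧ ∃ y : Site 3, (n : ℤ) ≤ y 0 ∧ ω ∈ openConnIn (halfSpace 3) q.2 y}

/-- The confinement event (the skeleton's `confined (3 * n)`): `U = C_ℍ(0)` stays in the open sup-ball `B_{3n}`. -/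
def conf (n : ℕ) : Set (BondConfig (Site 3)) :=
  {ω | ∀ y : Site 3, ω ∈ openConnIn (halfSpace 3) 0 y → ∀ i : Fin 3, |y i| < ((3 * n : ℕ) : ℤ)}

/-- The floor box of radius `R`: floor sites `x` (`x 0 = 0`) with `|x 1|, |x 2| ≤ R`. -/
def floorBox (R : ℕ) : Finset (Site 3) := (box 3 R).filter fun x => x 0 = 0

/-- The dyadic group of scale `2^k`: floor roots `x` with `3·2^k ≤ |x|_floor ≤ 8·2^k`. -/
def grp (k : ℕ) : Finset (Site 3) := (floorBox (8 * 2 ^ k)).filter fun x => 3 * 2 ^ k ≤ floorSup x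

/-- The two floor directions. -/
def dirs : Finset (Fin 3) := {1, 2}

/-- Admissible dyadic scales: `k ≤ log₂ n` with `d₀ ≤ 2^k`. -/
def scales (d₀ n : ℕ) : Finset ℕ := (Finset.range (Nat.log 2 n + 1)).filter fun k => d₀ ≤ 2 ^ k

/-- Index set of the far roots: triples `⟨k, x, j⟩`, `k ∈ scales d₀ n`, `x ∈ grp k`, `j ∈ dirs`. -/
def idx (d₀ n : ℕ) : Finset ((_ : ℕ) × (Site 3 × Fin 3)) := (scales d₀ n).sigma fun k => grp k ×ˢ dirs

/-- The two orientations of the floor edge `(x, x + e_j)`. -/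
def pairSet (x : Site 3) (j : Fin 3) : Finset (Site 3 × Site 3) :=
  {(x, x + Pi.single j 1), (x + Pi.single j 1, x)}

/-- The cover of the partner-kiss edges on the confined event: all edges at the near roots, and the edges at
the far roots `x ∈ grp k` whose kiss event `kissV (2^k) x j` occurs. -/
def cover (d₀ n : ℕ) (ω : BondConfig (Site 3)) : Finset (Site 3 × Site 3) :=
  ((floorBox (6 * d₀ + 2)).biUnion fun x => dirs.biUnion fun j => pairSet x j) ∪
    (idx d₀ n).biUnion fun t => if ω ∈ kissV (2 ^ t.1) t.2.1 t.2.2 then pairSet t.2.1 t.2.2 else ∅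

/-- The counting majorant `N = 2 #F_small + Σ_{⟨k,x,j⟩ ∈ idx} 1{kissV (2^k) x j}` (so that `K_n ≤ 2N`). -/
def bigN (d₀ n : ℕ) (ω : BondConfig (Site 3)) : ℕ :=
  2 * (floorBox (6 * d₀ + 2)).card + ∑ t ∈ idx d₀ n, if ω ∈ kissV (2 ^ t.1) t.2.1 t.2.2 then 1 else 0

/-! ### Floor boxes -/

/-- Membership in the floor box. -/
theorem mem_floorBox {R : ℕ} {x : Site 3} : x ∈ floorBox R ↔ x 0 = 0 ∧ floorSup x ≤ R := by
  rw [floorBox, Finset.mem_filter, mem_box, floorSup, max_le_iff]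
  constructor
  · rintro ⟨h, h0⟩
    have h1 := h 1
    have h2 := h 2
    exact ⟨h0, by omega, by omega⟩
  · rintro ⟨h0, h1, h2⟩
    refine ⟨fun i => ?_, h0⟩
    fin_cases i
    · simp only [Fin.zero_eta]; omega
    · simp only [Fin.mk_one]; omega
    · simp only [Fin.reduceFinMk]; omega

/-- The floor box has at most `(2R+1)²` sites. -/
theorem card_floorBox_le (R : ℕ) : (floorBox R).card ≤ (2 * R + 1) ^ 2 :=
  card_filter_box_apply_eq_le R 0 0

/-- Members of a dyadic group. -/
theorem mem_grp {k : ℕ} {x : Site 3} :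
    x ∈ grp k ↔ (x 0 = 0 ∧ floorSup x ≤ 8 * 2 ^ k) ∧ 3 * 2 ^ k ≤ floorSup x := by
  rw [grp, Finset.mem_filter, mem_floorBox]

/-- A dyadic group has at most `(16·2^k + 1)²` roots. -/
theorem card_grp_le (k : ℕ) : (grp k).card ≤ (16 * 2 ^ k + 1) ^ 2 :=
  calc (grp k).card ≤ (floorBox (8 * 2 ^ k)).card := Finset.card_filter_le _ _
    _ ≤ (2 * (8 * 2 ^ k) + 1) ^ 2 := card_floorBox_le _
    _ = (16 * 2 ^ k + 1) ^ 2 := by ring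

/-- Members of the set of admissible scales. -/
theorem mem_scales {d₀ n k : ℕ} : k ∈ scales d₀ n ↔ k ≤ Nat.log 2 n ∧ d₀ ≤ 2 ^ k := by
  rw [scales, Finset.mem_filter, Finset.mem_range, Nat.lt_succ_iff]

/-- Members of the index set. -/
theorem mem_idx {d₀ n : ℕ} {t : (_ : ℕ) × (Site 3 × Fin 3)} :
    t ∈ idx d₀ n ↔ t.1 ∈ scales d₀ n ∧ t.2.1 ∈ grp t.1 ∧ t.2.2 ∈ dirs := by
  rw [idx, Finset.mem_sigma, Finset.mem_product]

/-- The floor directions are `1` and `2`. -/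
theorem mem_dirs {j : Fin 3} : j ∈ dirs ↔ j = 1 ∨ j = 2 := by
  rw [dirs, Finset.mem_insert, Finset.mem_singleton]

/-- There are two floor directions. -/
theorem card_dirs : dirs.card = 2 := by
  rw [dirs, Finset.card_pair (by decide)]

/-- A floor direction is not the vertical one. -/
theorem ne_zero_of_mem_dirs {j : Fin 3} (h : j ∈ dirs) : j ≠ 0 := by
  rcases mem_dirs.1 h with rfl | rfl <;> decide

/-- The edge pair has at most two elements. -/
theorem card_pairSet_le (x : Site 3) (j : Fin 3) : (pairSet x j).card ≤ 2 := Finset.card_le_two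

/-! ### Geometry of confinement -/

/-- A confined site has floor distance `≤ 3n`. -/
theorem floorSup_le_of_abs_lt {n : ℕ} {q : Site 3} (h : ∀ i : Fin 3, |q i| < ((3 * n : ℕ) : ℤ)) :
    floorSup q ≤ 3 * n := by
  have h1 := abs_lt.1 (h 1)
  have h2 := abs_lt.1 (h 2)
  rw [floorSup, max_le_iff]
  constructor <;> omega

/-- A lattice neighbour `x` of a confined site `q = x + e_i` has floor distance `≤ 3n`. -/
theorem floorSup_le_of_adj {n : ℕ} {q x : Site 3} {i : Fin 3} (hq : q = x + Pi.single i 1)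
    (h : ∀ k : Fin 3, |q k| < ((3 * n : ℕ) : ℤ)) : floorSup x ≤ 3 * n := by
  have h1 := abs_lt.1 (h 1)
  have h2 := abs_lt.1 (h 2)
  rw [hq, Pi.add_apply, Pi.single_apply] at h1 h2
  rw [floorSup, max_le_iff]
  constructor
  · split_ifs at h1 <;> omega
  · split_ifs at h2 <;> omega

/-! ### The cover of the partner-kiss edges (S2) -/

/-- **Root cover.** A floor root `x` (`x 0 = 0`, `|x|_floor ≤ 3n`) with a floor direction `j` such that
`kissV n x j` occurs has both orientations of its edge in the cover. -/
theorem pairSet_subset_cover {d₀ n : ℕ} {ω : BondConfig (Site 3)} {x : Site 3} {j : Fin 3}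
    (hx0 : x 0 = 0) (hj : j ≠ 0) (hsup : floorSup x ≤ 3 * n) (hkiss : ω ∈ kissV n x j) :
    pairSet x j ⊆ cover d₀ n ω := by
  intro q hq
  have hjd : j ∈ dirs := mem_dirs.2 (eq_one_or_two_of_ne_zero hj)
  rw [cover, Finset.mem_union]
  by_cases hsmall : floorSup x ≤ 6 * d₀ + 2
  · left
    rw [Finset.mem_biUnion]
    exact ⟨x, mem_floorBox.2 ⟨hx0, hsmall⟩, Finset.mem_biUnion.2 ⟨j, hjd, hq⟩⟩
  · right
    have hsmall' := not_le.1 hsmall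
    set r := floorSup x with hr
    set k := Nat.log 2 (r / 3) with hk
    have hr3 : r / 3 ≠ 0 := by omega
    have hk1 : 2 ^ k ≤ r / 3 := Nat.pow_log_le_self 2 hr3
    have hk2 : r / 3 < 2 ^ (k + 1) := Nat.lt_pow_succ_log_self (by norm_num) _
    have hP : 1 ≤ 2 ^ k := Nat.one_le_two_pow
    rw [pow_succ] at hk2
    have hd₀ : d₀ ≤ 2 ^ k := by omega
    have hkn : 2 ^ k ≤ n := by omega
    have hkL : k ≤ Nat.log 2 n := Nat.le_log_of_pow_le (by norm_num) hkn
    rw [Finset.mem_biUnion]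
    refine ⟨⟨k, (x, j)⟩, ?_, ?_⟩
    · rw [mem_idx]
      show k ∈ scales d₀ n ∧ x ∈ grp k ∧ j ∈ dirs
      exact ⟨mem_scales.2 ⟨hkL, hd₀⟩, mem_grp.2 ⟨⟨hx0, by omega⟩, by omega⟩, hjd⟩
    · have hev : ω ∈ kissV (2 ^ k) x j := kissV_antitone_level hkn x j hkiss
      dsimp only
      rw [if_pos hev]
      exact hq

/-- **The cover.** On `A_n ∩ conf n`, every partner-kiss edge lies in `cover d₀ n ω`. -/
theorem partnerKiss_subset_cover {d₀ n : ℕ} {ω : BondConfig (Site 3)} (hA : ω ∈ kissV n 0 1)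
    (hc : ω ∈ conf n) : partnerKiss n ω ⊆ ↑(cover d₀ n ω) := by
  rintro ⟨q₁, q₂⟩ ⟨h1, h2, hadj, hU, hnU, htall⟩
  dsimp only at h1 h2 hadj hU hnU htall
  rw [Finset.mem_coe]
  obtain ⟨y₀, hy₀, hc₀⟩ := hA.1
  -- `C_ℍ(q₁) = U` meets level `n`
  have ht₁ : ∃ y : Site 3, (n : ℤ) ≤ y 0 ∧ ω ∈ openConnIn (halfSpace 3) q₁ y :=
    ⟨y₀, hy₀, GM.openConnIn_trans (GM.openConnIn_comm.1 hU) hc₀⟩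
  -- `q₁ ↮ q₂`
  have hsep : ω ∉ openConnIn (halfSpace 3) q₁ q₂ := fun h => hnU (GM.openConnIn_trans hU h)
  -- confinement of `q₁ ∈ U`
  have hconf : ∀ i : Fin 3, |q₁ i| < ((3 * n : ℕ) : ℤ) := hc q₁ hU
  obtain ⟨i, hi⟩ := (zdGraph_adj_iff q₁ q₂).1 hadj
  rcases hi with hq | hq
  · -- `q₂ = q₁ + e_i`: root `q₁`
    have hi0 : i ≠ 0 := by
      rintro rfl
      have := congrFun hq 0
      simp only [Pi.add_apply, Pi.single_eq_same] at this
      omega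
    subst hq
    have hkiss : ω ∈ kissV n q₁ i := ⟨ht₁, htall, hsep⟩
    exact pairSet_subset_cover h1 hi0 (floorSup_le_of_abs_lt hconf) hkiss
      (by rw [pairSet]; exact Finset.mem_insert_self _ _)
  · -- `q₁ = q₂ + e_i`: root `q₂`
    have hi0 : i ≠ 0 := by
      rintro rfl
      have := congrFun hq 0
      simp only [Pi.add_apply, Pi.single_eq_same] at this
      omega
    subst hq
    have hsep' : ω ∉ openConnIn (halfSpace 3) q₂ (q₂ + Pi.single i 1) :=
      fun h => hsep (GM.openConnIn_comm.1 h)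
    have hkiss : ω ∈ kissV n q₂ i := ⟨htall, ht₁, hsep'⟩
    exact pairSet_subset_cover h2 hi0 (floorSup_le_of_adj rfl hconf) hkiss
      (by rw [pairSet]; exact Finset.mem_insert_of_mem (Finset.mem_singleton_self _))

/-- The cover has at most `2 · bigN` elements. -/
theorem card_cover_le (d₀ n : ℕ) (ω : BondConfig (Site 3)) : (cover d₀ n ω).card ≤ 2 * bigN d₀ n ω := by
  have hA : ((floorBox (6 * d₀ + 2)).biUnion fun x => dirs.biUnion fun j => pairSet x j).card ≤
      4 * (floorBox (6 * d₀ + 2)).card := by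
    calc _ ≤ ∑ x ∈ floorBox (6 * d₀ + 2), (dirs.biUnion fun j => pairSet x j).card := Finset.card_biUnion_le
      _ ≤ ∑ x ∈ floorBox (6 * d₀ + 2), ∑ j ∈ dirs, (pairSet x j).card :=
          Finset.sum_le_sum fun x _ => Finset.card_biUnion_le
      _ ≤ ∑ x ∈ floorBox (6 * d₀ + 2), ∑ _j ∈ dirs, 2 :=
          Finset.sum_le_sum fun x _ => Finset.sum_le_sum fun j _ => card_pairSet_le x j
      _ = 4 * (floorBox (6 * d₀ + 2)).card := by
          simp only [Finset.sum_const, card_dirs, smul_eq_mul]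
          ring
  have hB : ((idx d₀ n).biUnion fun t =>
      if ω ∈ kissV (2 ^ t.1) t.2.1 t.2.2 then pairSet t.2.1 t.2.2 else ∅).card ≤
      2 * ∑ t ∈ idx d₀ n, if ω ∈ kissV (2 ^ t.1) t.2.1 t.2.2 then 1 else 0 := by
    calc _ ≤ ∑ t ∈ idx d₀ n, (if ω ∈ kissV (2 ^ t.1) t.2.1 t.2.2 then pairSet t.2.1 t.2.2 else ∅).card :=
          Finset.card_biUnion_le
      _ ≤ ∑ t ∈ idx d₀ n, 2 * (if ω ∈ kissV (2 ^ t.1) t.2.1 t.2.2 then 1 else 0) := by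
          refine Finset.sum_le_sum fun t _ => ?_
          split_ifs
          · simpa using card_pairSet_le t.2.1 t.2.2
          · simp
      _ = 2 * ∑ t ∈ idx d₀ n, if ω ∈ kissV (2 ^ t.1) t.2.1 t.2.2 then 1 else 0 := by
          rw [Finset.mul_sum]
  calc (cover d₀ n ω).card ≤ _ + _ := Finset.card_union_le _ _
    _ ≤ 4 * (floorBox (6 * d₀ + 2)).card +
          2 * ∑ t ∈ idx d₀ n, (if ω ∈ kissV (2 ^ t.1) t.2.1 t.2.2 then 1 else 0) := add_le_add hA hB
    _ = 2 * bigN d₀ n ω := by rw [bigN]; ring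

/-- **(S2) Counting.** On `A_n ∩ conf n`: `K_n(ω) = (partnerKiss n ω).ncard ≤ 2 · bigN d₀ n ω`. -/
theorem ncard_partnerKiss_le {d₀ n : ℕ} {ω : BondConfig (Site 3)} (hA : ω ∈ kissV n 0 1)
    (hc : ω ∈ conf n) : (partnerKiss n ω).ncard ≤ 2 * bigN d₀ n ω := by
  calc (partnerKiss n ω).ncard ≤ (↑(cover d₀ n ω) : Set (Site 3 × Site 3)).ncard :=
        Set.ncard_le_ncard (partnerKiss_subset_cover hA hc) (Finset.finite_toSet _)
    _ = (cover d₀ n ω).card := Set.ncard_coe_finset _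
    _ ≤ 2 * bigN d₀ n ω := card_cover_le d₀ n ω

/-- **(S3) The split** (no measurability of `K_n` needed): for every `k`,
`A_n ∩ conf n ⊆ (A_n ∩ {K_n ≤ k}) ∪ (A_n ∩ {k < 2N})`. -/
theorem inter_conf_subset_union (d₀ n k : ℕ) :
    kissV n 0 1 ∩ conf n ⊆
      (kissV n 0 1 ∩ {ω | (partnerKiss n ω).ncard ≤ k}) ∪ (kissV n 0 1 ∩ {ω | k < 2 * bigN d₀ n ω}) := by
  rintro ω ⟨hA, hc⟩
  by_cases hk : (partnerKiss n ω).ncard ≤ k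
  · exact Or.inl ⟨hA, hk⟩
  · exact Or.inr ⟨hA, lt_of_lt_of_le (not_le.1 hk) (ncard_partnerKiss_le hA hc)⟩

/-! ### Markov for a finite sum of indicators (S3) -/

/-- **Markov for a counting variable.** For measurable events `A`, `B_i` (`i ∈ I`) and `c, k ∈ ℕ`:
`(k+1) · P(A ∩ {k < 2(c + #{i | B_i})}) ≤ 2c · P(A) + 2 Σ_i P(A ∩ B_i)`. -/
theorem markov_count {ι : Type*} (I : Finset ι) {A : Set (BondConfig (Site 3))} (hA : MeasurableSet A)
    (B : ι → Set (BondConfig (Site 3))) (hB : ∀ i ∈ I, MeasurableSet (B i)) (c k : ℕ) :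
    ((k : ℝ) + 1) * μ.real (A ∩ {ω | k < 2 * (c + ∑ i ∈ I, if ω ∈ B i then 1 else 0)}) ≤
      2 * (c : ℝ) * μ.real A + 2 * ∑ i ∈ I, μ.real (A ∩ B i) := by
  have hAB : ∀ i ∈ I, MeasurableSet (A ∩ B i) := fun i hi => hA.inter (hB i hi)
  have hintA : Integrable (A.indicator fun _ => (2 * c : ℝ)) μ := (integrable_const _).indicator hA
  have hint_i : ∀ i ∈ I, Integrable ((A ∩ B i).indicator fun _ => (2 : ℝ)) μ :=
    fun i hi => (integrable_const _).indicator (hAB i hi)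
  have hintS : Integrable (fun ω => ∑ i ∈ I, (A ∩ B i).indicator (fun _ => (2 : ℝ)) ω) μ :=
    integrable_finsetSum I hint_i
  have hint : Integrable (fun ω => A.indicator (fun _ => (2 * c : ℝ)) ω +
      ∑ i ∈ I, (A ∩ B i).indicator (fun _ => (2 : ℝ)) ω) μ := hintA.add hintS
  have hnn : 0 ≤ᵐ[μ] fun ω => A.indicator (fun _ => (2 * c : ℝ)) ω +
      ∑ i ∈ I, (A ∩ B i).indicator (fun _ => (2 : ℝ)) ω :=
    ae_of_all _ fun ω => add_nonneg (Set.indicator_nonneg (fun _ _ => by positivity) _)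
      (Finset.sum_nonneg fun i _ => Set.indicator_nonneg (fun _ _ => by norm_num) _)
  -- the integral
  have hI : ∫ ω, (A.indicator (fun _ => (2 * c : ℝ)) ω +
      ∑ i ∈ I, (A ∩ B i).indicator (fun _ => (2 : ℝ)) ω) ∂μ =
      2 * (c : ℝ) * μ.real A + 2 * ∑ i ∈ I, μ.real (A ∩ B i) := by
    rw [integral_add hintA hintS, integral_finsetSum I hint_i, integral_indicator_const _ hA,
      smul_eq_mul, Finset.mul_sum]
    congr 1
    · ring
    · refine Finset.sum_congr rfl fun i hi => ?_
      rw [integral_indicator_const _ (hAB i hi), smul_eq_mul, mul_comm]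
  -- Markov
  have hM := mul_meas_ge_le_integral_of_nonneg hnn hint ((k : ℝ) + 1)
  rw [hI] at hM
  refine le_trans (mul_le_mul_of_nonneg_left (measureReal_mono ?_) (by positivity)) hM
  -- the inclusion `A ∩ {k < 2(c + Σ)} ⊆ {k + 1 ≤ g}`
  rintro ω ⟨hωA, hωk⟩
  rw [Set.mem_setOf_eq] at hωk ⊢
  have hind : ∀ i ∈ I, (A ∩ B i).indicator (fun _ => (2 : ℝ)) ω = 2 * (if ω ∈ B i then 1 else 0) := by
    intro i _
    by_cases hBi : ω ∈ B i
    · rw [if_pos hBi, Set.indicator_of_mem (Set.mem_inter hωA hBi)]; norm_num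
    · rw [if_neg hBi, Set.indicator_of_notMem (fun h => hBi h.2)]; norm_num
  rw [Set.indicator_of_mem hωA, Finset.sum_congr rfl hind, ← Finset.mul_sum]
  have hk' : k + 1 ≤ 2 * (c + ∑ i ∈ I, if ω ∈ B i then 1 else 0) := hωk
  have := (Nat.cast_le (α := ℝ)).2 hk'
  push_cast at this
  linarith

/-- **(S3) Markov for the counting majorant.** For `k ∈ ℕ`:
`(k+1) P(A_n ∩ {k < 2N}) ≤ 4 #F_small P(A_n) + 2 Σ_{⟨k',x,j⟩ ∈ idx} P(A_n ∩ kissV (2^{k'}) x j)`. -/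
theorem markov_bigN (d₀ n k : ℕ) :
    ((k : ℝ) + 1) * μ.real (kissV n 0 1 ∩ {ω | k < 2 * bigN d₀ n ω}) ≤
      4 * ((floorBox (6 * d₀ + 2)).card : ℝ) * μ.real (kissV n 0 1) +
        2 * ∑ t ∈ idx d₀ n, μ.real (kissV n 0 1 ∩ kissV (2 ^ t.1) t.2.1 t.2.2) := by
  have h := markov_count (idx d₀ n) (measurableSet_kissV n 0 1) (fun t => kissV (2 ^ t.1) t.2.1 t.2.2)
    (fun t _ => measurableSet_kissV _ _ _) (2 * (floorBox (6 * d₀ + 2)).card) k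
  have e : ((2 * (floorBox (6 * d₀ + 2)).card : ℕ) : ℝ) = 2 * ((floorBox (6 * d₀ + 2)).card : ℝ) := by
    push_cast; ring
  rw [e] at h
  calc _ ≤ _ := h
    _ = _ := by ring

/-! ### The level densities (S6, first line) -/

/-- **(S6) Exact-height densities sum to at most the tall density.** For a finite set `I` of levels `≥ N`:
`Σ_{m ∈ I} E[1{height U = m}/|U ∩ ∂ℍ|] ≤ E[1{U meets level N}/|U ∩ ∂ℍ|]` — the exact-height events are
pairwise disjoint and contained in `{U meets level N}`. -/
theorem sum_exactDens_le_tallDens (N : ℕ) (I : Finset ℕ) (hI : ∀ m ∈ I, N ≤ m) :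
    ∑ m ∈ I, ∫⁻ ω, {ω | (∃ y : Site 3, (m : ℤ) ≤ y 0 ∧ ω ∈ openConnIn (halfSpace 3) 0 y) ∧
        ¬ (∃ y : Site 3, ((m + 1 : ℕ) : ℤ) ≤ y 0 ∧ ω ∈ openConnIn (halfSpace 3) 0 y)}.indicator
        (fun ω => (((halfSpaceFootprint ω : ℕ∞) : ENNReal))⁻¹) ω ∂μ ≤
      ∫⁻ ω, {ω | ∃ y : Site 3, (N : ℤ) ≤ y 0 ∧ ω ∈ openConnIn (halfSpace 3) 0 y}.indicator
        (fun ω => (((halfSpaceFootprint ω : ℕ∞) : ENNReal))⁻¹) ω ∂μ := by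
  set w : BondConfig (Site 3) → ℝ≥0∞ := fun ω => (((halfSpaceFootprint ω : ℕ∞) : ENNReal))⁻¹ with hw
  set E : ℕ → Set (BondConfig (Site 3)) := fun m =>
    {ω | (∃ y : Site 3, (m : ℤ) ≤ y 0 ∧ ω ∈ openConnIn (halfSpace 3) 0 y) ∧
      ¬ (∃ y : Site 3, ((m + 1 : ℕ) : ℤ) ≤ y 0 ∧ ω ∈ openConnIn (halfSpace 3) 0 y)} with hE
  have hEmeas : ∀ m, MeasurableSet (E m) := fun m =>
    measurableSet_setOf.2 ((measurable_tall m 0).and (measurable_tall (m + 1) 0).not)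
  have hwmeas : Measurable w :=
    ((Measurable.of_discrete (f := fun n : ℕ∞ => (n : ℝ≥0∞))).comp measurable_halfSpaceFootprint).inv
  change ∑ m ∈ I, ∫⁻ ω, (E m).indicator w ω ∂μ ≤
    ∫⁻ ω, {ω | ∃ y : Site 3, (N : ℤ) ≤ y 0 ∧ ω ∈ openConnIn (halfSpace 3) 0 y}.indicator w ω ∂μ
  rw [← lintegral_finsetSum I fun m _ => hwmeas.indicator (hEmeas m)]
  refine lintegral_mono fun ω => ?_
  have hdisj : (↑I : Set ℕ).PairwiseDisjoint E := by
    intro m _ m' _ hne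
    rw [Function.onFun, Set.disjoint_left]
    rintro ω' ⟨⟨y, hy, hcy⟩, hn⟩ ⟨⟨y', hy', hcy'⟩, hn'⟩
    rcases Nat.lt_or_gt_of_ne hne with hlt | hlt
    · exact hn ⟨y', le_trans (by exact_mod_cast hlt) hy', hcy'⟩
    · exact hn' ⟨y, le_trans (by exact_mod_cast hlt) hy, hcy⟩
  rw [← Finset.indicator_biUnion_apply I E hdisj]
  refine Set.indicator_le_indicator_of_subset (Set.iUnion₂_subset fun m hm => ?_) (fun _ => zero_le) ω
  rintro ω' ⟨⟨y, hy, hcy⟩, -⟩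
  exact ⟨y, le_trans (by exact_mod_cast hI m hm) hy, hcy⟩

end StubStep

/-- **Registered sub-goal `stub_step_count`** (def-free summary of this helper file): for levels `m ∈ I`, all
`≥ N`, the exact-height densities `e_m = E[1{height U = m}/|U ∩ ∂ℍ|]` sum to at most the tall density
`ν_N = E[1{U meets level N}/|U ∩ ∂ℍ|]` (`StubStep.sum_exactDens_le_tallDens`). -/
theorem stub_step_count : ∀ (N : ℕ) (I : Finset ℕ), (∀ m ∈ I, N ≤ m) → ∑ m ∈ I, (∫⁻ ω, {ω | (∃ y : Site 3, (m : ℤ) ≤ y 0 ∧ ω ∈ openConnIn (halfSpace 3) 0 y) ∧ ¬ (∃ y : Site 3, ((m + 1 : ℕ) : ℤ) ≤ y 0 ∧ ω ∈ openConnIn (halfSpace 3) 0 y)}.indicator (fun ω => (((halfSpaceFootprint ω : ℕ∞) : ENNReal))⁻¹) ω ∂(bondPercolation (zdGraph 3) (criticalProbI 3))) ≤ ∫⁻ ω, {ω | ∃ y : Site 3, (N : ℤ) ≤ y 0 ∧ ω ∈ openConnIn (halfSpace 3) 0 y}.indicator (fun ω => (((halfSpaceFootprint ω : ℕ∞) :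 ENNReal))⁻¹) ω ∂(bondPercolation (zdGraph 3) (criticalProbI 3)) :=
  fun N I hI => StubStep.sum_exactDens_le_tallDens N I hI

end Summit.CriticalPhenomena.PercolationContinuityZ3.Theorems.BoundaryTwoArmDecay

end
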